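import Summits.HodgeConjecture.HodgeConjecture.Theorems.HodgeLocusCensusPlaneSumCert
import HarnessLib

/-!
# HodgeLocusCensusCubicCert — the plane-sum core for CUBIC Fermat hypersurfaces (d = 3): ℤ[ζ₆] model, core, kernel-checkable LU certificates (cell pub-hlocus, LEAD gen 5, (T39))
HONEST FRAMING: certified instances and evidence bearing on the general Hodge conjecture; no claim.

The d = 3 companion of `HodgeLocusCensusPlaneSumCert` (d = 4). On the Fermat CUBIC n-fold (k = n/2, k+1 coordinate pairs) the schema period of a
coordinate k-plane with b = id and odd twists a is p_i(Π) = [every pair sum of i is 1] · ζ^{Σ_e (i_{2e}+1)(1+2a_{2e+1})}, ζ a primitive SIXTH root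
of unity (ζ² = ζ − 1). For a signed sum of such planes twisted only on the LAST THREE pairs (the HEAD pairs; the schema planes `standardP n`,
`standardPc n m 1` of the cubic census rows are of this kind) the entry (i,j) of Movasati's matrix is [pair sums of i+j all 1] · ζ^{tails} · C(heads
of i+j) with the CORE C(a,b,e) = Σ_P c_P ζ^{(a+1)(1+2a_P)+(b+1)(1+2b_P)+(e+1)(1+2e_P)} ∈ ℤ[ζ₆], a, b, e ∈ {0,1}. Hence the matrix is block diagonal
in the pair-sum type σ ∈ {0,1}^{k+1} of the row (|σ| = k − 2; rows with a pair sum 2 vanish), the block of a type with head shape s ∈ {0,1}³ is, up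
to nonzero scalings and duplications, the CORE MATRIX C_s = [C(h+g)], h ∈ ∏[0,s_e], g ∈ ∏[0,1−s_e], and rank M_δ(X³_n) = Σ_types rank C_{shape}.
This file: `Z6` = ℤ[x]/(x² − x + 1) on integer pairs with `Z6.eval ζ`; the core `core3`; `CubicCert` (per shape: rank r_s, ordered pivots, INTEGRAL
factors A_s, B_s with Σ_ℓ A_s B_s = C_s, triangular on the pivots, pivots positive integers resp. with a norm cofactor) with the Boolean `valid`
decided by `decide +kernel` in the class file and its soundness lemmas. List plumbing (`lget`, `Z8.allLT`, `sum_modes`) is reused from the d = 4 file.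
Numbers reproduced (gen_cert3.py, exact ℚ(ζ₆) + independent brute-force schema matrices): [P]+[P_c] 7/19/38 (n = 6/8/10), [P]−[P_c] 1/6/16/32
(n = 4/6/8/10) — the seven rows of `HodgeLocusCensusCubicRows`; single plane 1/4/10/20.
-/

namespace Summit.HodgeConjecture.HodgeConjecture.HodgeLocus.Census.CubicSum

open PlaneSum

/-! ## ℤ[ζ₆] as integer pairs -/

/-- ℤ[x]/(x² − x + 1): c₀ + c₁x. -/
structure Z6 where
  c0 : ℤ
  c1 : ℤ
deriving DecidableEq

namespace Z6

/-- addition. -/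
def add (x y : Z6) : Z6 := ⟨x.c0 + y.c0, x.c1 + y.c1⟩
/-- multiplication modulo x² = x − 1. -/
def mul (x y : Z6) : Z6 := ⟨x.c0 * y.c0 - x.c1 * y.c1, x.c0 * y.c1 + x.c1 * y.c0 + x.c1 * y.c1⟩
/-- 0. -/
instance : Zero Z6 := ⟨⟨0, 0⟩⟩
/-- +. -/
instance : Add Z6 := ⟨add⟩
/-- ·. -/
instance : Mul Z6 := ⟨mul⟩
/-- unfolding 0. -/
theorem zero_def : (0 : Z6) = ⟨0, 0⟩ := rfl
/-- unfolding +. -/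
theorem add_def (x y : Z6) : x + y = add x y := rfl
/-- unfolding ·. -/
theorem mul_def (x y : Z6) : x * y = mul x y := rfl
/-- integer multiple. -/
def smul (c : ℤ) (x : Z6) : Z6 := ⟨c * x.c0, c * x.c1⟩
/-- the monomial x^k reduced with x² = x − 1 (x³ = −1, x⁶ = 1). -/
def mono (k : ℕ) : Z6 :=
  if k % 6 = 0 then ⟨1, 0⟩ else if k % 6 = 1 then ⟨0, 1⟩ else if k % 6 = 2 then ⟨-1, 1⟩ else if k % 6 = 3 then ⟨-1, 0⟩
  else if k % 6 = 4 then ⟨0, -1⟩ else ⟨1, -1⟩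
/-- Σ_{ℓ < n} f ℓ. -/
def rsum : ℕ → (ℕ → Z6) → Z6
  | 0, _ => 0
  | n + 1, f => rsum n f + f n
/-- "is a positive rational integer" (Boolean test). -/
def isPosConst (x : Z6) : Bool := decide (0 < x.c0) && decide (x.c1 = 0)

variable {K : Type*} [CommRing K] (ζ : K)

/-- evaluation at ζ. -/
def eval (x : Z6) : K := (x.c0 : K) + (x.c1 : K) * ζ
/-- eval 0 = 0. -/
theorem eval_zero : eval ζ (⟨0, 0⟩ : Z6) = 0 := by simp [eval]
/-- additivity. -/
theorem eval_add (x y : Z6) : eval ζ (x + y) = eval ζ x + eval ζ y := by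
  simp only [eval, add_def, add]
  push_cast
  ring
/-- integer multiples. -/
theorem eval_smul (c : ℤ) (x : Z6) : eval ζ (smul c x) = (c : K) * eval ζ x := by
  simp only [eval, smul]
  push_cast
  ring
/-- multiplicativity needs ζ² = ζ − 1. -/
theorem eval_mul (h2 : ζ ^ 2 = ζ - 1) (x y : Z6) : eval ζ (x * y) = eval ζ x * eval ζ y := by
  simp only [eval, mul_def, mul]
  push_cast
  linear_combination (-((x.c1 : K) * y.c1)) * h2
/-- eval of the monomial x^k is ζ^k (ζ² = ζ − 1). -/
theorem eval_mono (h2 : ζ ^ 2 = ζ - 1) (k : ℕ) : eval ζ (mono k) = ζ ^ k := by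
  have h3 : ζ ^ 3 = -1 := by linear_combination (ζ + 1) * h2
  have h6 : ζ ^ 6 = 1 := by linear_combination (ζ ^ 3 - 1) * h3
  have h4 : ζ ^ 4 = -ζ := by linear_combination ζ * h3
  have h5 : ζ ^ 5 = 1 - ζ := by linear_combination ζ ^ 2 * h3 - h2
  rw [show ζ ^ k = ζ ^ (k % 6) by
    conv_lhs => rw [← Nat.div_add_mod k 6]
    rw [pow_add, pow_mul, h6, one_pow, one_mul]]
  unfold mono
  have hk : k % 6 < 6 := Nat.mod_lt _ (by norm_num)
  generalize k % 6 = q at *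
  interval_cases q <;> simp [eval, h2, h3, h4, h5] <;> ring
/-- eval of a bounded sum. -/
theorem eval_rsum (n : ℕ) (f : ℕ → Z6) : eval ζ (rsum n f) = ∑ ℓ ∈ Finset.range n, eval ζ (f ℓ) := by
  induction n with
  | zero => simp [rsum, zero_def, eval_zero]
  | succ n ih => rw [rsum, eval_add, ih, Finset.sum_range_succ]
/-- unfolding `isPosConst`. -/
theorem isPosConst_iff (x : Z6) : x.isPosConst = true ↔ 0 < x.c0 ∧ x.c1 = 0 := by
  simp [isPosConst]
/-- a positive integer constant evaluates to itself … -/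
theorem eval_posConst {x : Z6} (h : x.isPosConst = true) : eval ζ x = (x.c0 : K) := by
  obtain ⟨_, h1⟩ := (isPosConst_iff x).mp h
  simp [eval, h1]
/-- … hence is nonzero in characteristic 0. -/
theorem eval_ne_zero_of_posConst {F : Type*} [Field F] [CharZero F] (ζ : F) {x : Z6} (h : x.isPosConst = true) : eval ζ x ≠ 0 := by
  rw [eval_posConst ζ h]
  exact_mod_cast ((isPosConst_iff x).mp h).1.ne'

end Z6

/-! ## The core of a signed plane sum (d = 3) -/

/-- C(a,b,e) = Σ_P c_P ζ₆^{(a+1)(1+2a_P)+(b+1)(1+2b_P)+(e+1)(1+2e_P)} for the class L = [(c_P, a_P, b_P, e_P)] (twists of the three head pairs). -/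
def core3 : List (ℤ × ℕ × ℕ × ℕ) → ℕ → ℕ → ℕ → Z6
  | [], _, _, _ => 0
  | p :: L, a, b, e => Z6.smul p.1 (Z6.mono ((a + 1) * (1 + 2 * p.2.1) + (b + 1) * (1 + 2 * p.2.2.1) + (e + 1) * (1 + 2 * p.2.2.2))) + core3 L a b e

variable {K : Type*} [Field K] (ζ : K)

/-- eval of the core is the signed sum of the plane periods' head factors. -/
theorem eval_core3 (h2 : ζ ^ 2 = ζ - 1) (L : List (ℤ × ℕ × ℕ × ℕ)) (a b e : ℕ) : Z6.eval ζ (core3 L a b e) =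
    (L.map fun p => (p.1 : K) * ζ ^ ((a + 1) * (1 + 2 * p.2.1) + (b + 1) * (1 + 2 * p.2.2.1) + (e + 1) * (1 + 2 * p.2.2.2))).sum := by
  induction L with
  | nil => simp [core3, Z6.zero_def, Z6.eval_zero]
  | cons p L ih => rw [core3, Z6.eval_add, Z6.eval_smul, Z6.eval_mono ζ h2, ih, List.map_cons, List.sum_cons]

/-! ## Core certificates (d = 3) -/

/-- per shape s ∈ {0,1}³ (position 4s₀+2s₁+s₂): the rank r_s of the core matrix, r_s ordered pivot rows h ∈ ∏[0,s_e] and columns g ∈ ∏[0,1−s_e],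
the factor A_s (rows h in lexicographic order, r_s columns), the factor B_s (r_s rows, columns g in lexicographic order) and the r_s norm cofactors
of the B-pivots — all in ℤ[ζ₆]. -/
structure CubicCert where
  rsh : List ℕ
  pr : List (List (ℕ × ℕ × ℕ))
  pc : List (List (ℕ × ℕ × ℕ))
  tA : List (List (List Z6))
  tB : List (List (List Z6))
  tw : List (List Z6)

namespace CubicCert

variable (Ψ : CubicCert)

/-- rank of the shape. -/
def rs (s0 s1 s2 : ℕ) : ℕ := lget 0 Ψ.rsh (4 * s0 + 2 * s1 + s2)
/-- the ℓ-th pivot row (a head triple h ≤ s) … -/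
def rowP (s0 s1 s2 ℓ : ℕ) : ℕ × ℕ × ℕ := lget (0, 0, 0) (lget [] Ψ.pr (4 * s0 + 2 * s1 + s2)) ℓ
/-- … and pivot column (a head triple g ≤ 1 − s). -/
def colP (s0 s1 s2 ℓ : ℕ) : ℕ × ℕ × ℕ := lget (0, 0, 0) (lget [] Ψ.pc (4 * s0 + 2 * s1 + s2)) ℓ
/-- A_s[(a,b,e), ℓ]. -/
def A (s0 s1 s2 a b e ℓ : ℕ) : Z6 := lget 0 (lget [] (lget [] Ψ.tA (4 * s0 + 2 * s1 + s2)) (a * ((s1 + 1) * (s2 + 1)) + b * (s2 + 1) + e)) ℓ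
/-- B_s[ℓ, (a,b,e)]. -/
def B (s0 s1 s2 ℓ a b e : ℕ) : Z6 := lget 0 (lget [] (lget [] Ψ.tB (4 * s0 + 2 * s1 + s2)) ℓ) (a * ((2 - s1) * (2 - s2)) + b * (2 - s2) + e)
/-- the norm cofactor of the ℓ-th B-pivot. -/
def w (s0 s1 s2 ℓ : ℕ) : Z6 := lget 0 (lget [] Ψ.tw (4 * s0 + 2 * s1 + s2)) ℓ

/-- (F) factorisation Σ_{ℓ<r_s} A_s[h,ℓ] B_s[ℓ,g] = C(h+g) on every shape s and every head pair (h ≤ s, g ≤ 1 − s). -/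
def validF (L : List (ℤ × ℕ × ℕ × ℕ)) : Bool :=
  Z8.allLT 2 fun s0 => Z8.allLT 2 fun s1 => Z8.allLT 2 fun s2 =>
    Z8.allLT (s0 + 1) fun a => Z8.allLT (s1 + 1) fun b => Z8.allLT (s2 + 1) fun e =>
      Z8.allLT (2 - s0) fun a' => Z8.allLT (2 - s1) fun b' => Z8.allLT (2 - s2) fun e' =>
        decide (Z6.rsum (Ψ.rs s0 s1 s2) (fun ℓ => Ψ.A s0 s1 s2 a b e ℓ * Ψ.B s0 s1 s2 ℓ a' b' e') = core3 L (a + a') (b + b') (e + e'))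
/-- (T) triangularity on the pivots: A_s[h_{ℓ₀}, ℓ] = 0 and B_s[ℓ, g_{ℓ₀}] = 0 for ℓ₀ < ℓ. -/
def validT : Bool :=
  Z8.allLT 2 fun s0 => Z8.allLT 2 fun s1 => Z8.allLT 2 fun s2 =>
    Z8.allLT (Ψ.rs s0 s1 s2) fun ℓ₀ => Z8.allLT (Ψ.rs s0 s1 s2) fun ℓ => decide (ℓ ≤ ℓ₀) ||
      (decide (Ψ.A s0 s1 s2 (Ψ.rowP s0 s1 s2 ℓ₀).1 (Ψ.rowP s0 s1 s2 ℓ₀).2.1 (Ψ.rowP s0 s1 s2 ℓ₀).2.2 ℓ = 0) &&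
       decide (Ψ.B s0 s1 s2 ℓ (Ψ.colP s0 s1 s2 ℓ₀).1 (Ψ.colP s0 s1 s2 ℓ₀).2.1 (Ψ.colP s0 s1 s2 ℓ₀).2.2 = 0))
/-- (P) pivots: A_s[h_ℓ, ℓ] is a positive integer, B_s[ℓ, g_ℓ] · w_ℓ is a positive integer, and the pivot triples lie in their boxes. -/
def validP : Bool :=
  Z8.allLT 2 fun s0 => Z8.allLT 2 fun s1 => Z8.allLT 2 fun s2 => Z8.allLT (Ψ.rs s0 s1 s2) fun ℓ =>
    (Ψ.A s0 s1 s2 (Ψ.rowP s0 s1 s2 ℓ).1 (Ψ.rowP s0 s1 s2 ℓ).2.1 (Ψ.rowP s0 s1 s2 ℓ).2.2 ℓ).isPosConst &&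
    (Ψ.B s0 s1 s2 ℓ (Ψ.colP s0 s1 s2 ℓ).1 (Ψ.colP s0 s1 s2 ℓ).2.1 (Ψ.colP s0 s1 s2 ℓ).2.2 * Ψ.w s0 s1 s2 ℓ).isPosConst &&
    decide ((Ψ.rowP s0 s1 s2 ℓ).1 ≤ s0 ∧ (Ψ.rowP s0 s1 s2 ℓ).2.1 ≤ s1 ∧ (Ψ.rowP s0 s1 s2 ℓ).2.2 ≤ s2 ∧
      (Ψ.colP s0 s1 s2 ℓ).1 ≤ 1 - s0 ∧ (Ψ.colP s0 s1 s2 ℓ).2.1 ≤ 1 - s1 ∧ (Ψ.colP s0 s1 s2 ℓ).2.2 ≤ 1 - s2)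
/-- VALIDITY of a certificate for the class L (a Boolean the class files evaluate in the kernel). -/
def valid (L : List (ℤ × ℕ × ℕ × ℕ)) : Bool := Ψ.validF L && Ψ.validT && Ψ.validP

variable {Ψ} {L : List (ℤ × ℕ × ℕ × ℕ)}

/-- soundness of (F). -/
theorem factor_eq (h : Ψ.valid L = true) {s0 s1 s2 a b e a' b' e' : ℕ} (h0 : s0 < 2) (h1 : s1 < 2) (h2 : s2 < 2)
    (ha : a < s0 + 1) (hb : b < s1 + 1) (he : e < s2 + 1) (ha' : a' < 2 - s0) (hb' : b' < 2 - s1) (he' : e' < 2 - s2) :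
    Z6.rsum (Ψ.rs s0 s1 s2) (fun ℓ => Ψ.A s0 s1 s2 a b e ℓ * Ψ.B s0 s1 s2 ℓ a' b' e') = core3 L (a + a') (b + b') (e + e') := by
  have hF : Ψ.validF L = true := by
    rw [valid, Bool.and_eq_true, Bool.and_eq_true] at h
    exact h.1.1
  simp only [validF, Z8.allLT_iff, decide_eq_true_eq] at hF
  exact hF s0 h0 s1 h1 s2 h2 a ha b hb e he a' ha' b' hb' e' he'

/-- soundness of (T), A part. -/
theorem A_upper_zero (h : Ψ.valid L = true) {s0 s1 s2 ℓ₀ ℓ : ℕ} (h0 : s0 < 2) (h1 : s1 < 2) (h2 : s2 < 2)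
    (hℓ₀ : ℓ₀ < Ψ.rs s0 s1 s2) (hℓ : ℓ < Ψ.rs s0 s1 s2) (hlt : ℓ₀ < ℓ) :
    Ψ.A s0 s1 s2 (Ψ.rowP s0 s1 s2 ℓ₀).1 (Ψ.rowP s0 s1 s2 ℓ₀).2.1 (Ψ.rowP s0 s1 s2 ℓ₀).2.2 ℓ = 0 := by
  have hT : Ψ.validT = true := by
    rw [valid, Bool.and_eq_true, Bool.and_eq_true] at h
    exact h.1.2
  simp only [validT, Z8.allLT_iff, Bool.or_eq_true, Bool.and_eq_true, decide_eq_true_eq] at hT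
  rcases hT s0 h0 s1 h1 s2 h2 ℓ₀ hℓ₀ ℓ hℓ with hle | ⟨hA, -⟩
  · omega
  · exact hA

/-- soundness of (T), B part. -/
theorem B_lower_zero (h : Ψ.valid L = true) {s0 s1 s2 ℓ₀ ℓ : ℕ} (h0 : s0 < 2) (h1 : s1 < 2) (h2 : s2 < 2)
    (hℓ₀ : ℓ₀ < Ψ.rs s0 s1 s2) (hℓ : ℓ < Ψ.rs s0 s1 s2) (hlt : ℓ₀ < ℓ) :
    Ψ.B s0 s1 s2 ℓ (Ψ.colP s0 s1 s2 ℓ₀).1 (Ψ.colP s0 s1 s2 ℓ₀).2.1 (Ψ.colP s0 s1 s2 ℓ₀).2.2 = 0 := by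
  have hT : Ψ.validT = true := by
    rw [valid, Bool.and_eq_true, Bool.and_eq_true] at h
    exact h.1.2
  simp only [validT, Z8.allLT_iff, Bool.or_eq_true, Bool.and_eq_true, decide_eq_true_eq] at hT
  rcases hT s0 h0 s1 h1 s2 h2 ℓ₀ hℓ₀ ℓ hℓ with hle | ⟨-, hB⟩
  · omega
  · exact hB

/-- soundness of (P). -/
theorem pivots (h : Ψ.valid L = true) {s0 s1 s2 ℓ : ℕ} (h0 : s0 < 2) (h1 : s1 < 2) (h2 : s2 < 2) (hℓ : ℓ < Ψ.rs s0 s1 s2) :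
    (Ψ.A s0 s1 s2 (Ψ.rowP s0 s1 s2 ℓ).1 (Ψ.rowP s0 s1 s2 ℓ).2.1 (Ψ.rowP s0 s1 s2 ℓ).2.2 ℓ).isPosConst = true ∧
    (Ψ.B s0 s1 s2 ℓ (Ψ.colP s0 s1 s2 ℓ).1 (Ψ.colP s0 s1 s2 ℓ).2.1 (Ψ.colP s0 s1 s2 ℓ).2.2 * Ψ.w s0 s1 s2 ℓ).isPosConst = true ∧
    ((Ψ.rowP s0 s1 s2 ℓ).1 ≤ s0 ∧ (Ψ.rowP s0 s1 s2 ℓ).2.1 ≤ s1 ∧ (Ψ.rowP s0 s1 s2 ℓ).2.2 ≤ s2 ∧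
      (Ψ.colP s0 s1 s2 ℓ).1 ≤ 1 - s0 ∧ (Ψ.colP s0 s1 s2 ℓ).2.1 ≤ 1 - s1 ∧ (Ψ.colP s0 s1 s2 ℓ).2.2 ≤ 1 - s2) := by
  have hP : Ψ.validP = true := by
    rw [valid, Bool.and_eq_true, Bool.and_eq_true] at h
    exact h.2
  simp only [validP, Z8.allLT_iff, Bool.and_eq_true, decide_eq_true_eq] at hP
  obtain ⟨⟨hA, hB⟩, hbox⟩ := hP s0 h0 s1 h1 s2 h2 ℓ hℓ
  exact ⟨hA, hB, hbox⟩

end CubicCert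

end Summit.HodgeConjecture.HodgeConjecture.HodgeLocus.Census.CubicSum
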